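import Literature.MathematicalPhysics.QuantumFieldTheory.Balaban1983to89.B6Geom246MultiLevelTorus
import Literature.MathematicalPhysics.QuantumFieldTheory.Balaban1983to89.B6CubeWindowV1

/-!
# `Balaban1983to89.Node00.MemberYRefineDomains` — THE n-FOLD REFINEMENT `η ↦ L⁻ⁿη` OF A NESTED TORUS FAMILY `{Ω_j}` (MODULE A of the member
# refinement `x ↦ x⁺` of the [B9] family index): the refined family `D⁺ = refineT D n` on the `Lⁿ`-finer torus, the block embedding
# `ιB : 𝔅 → 𝔅⁺`, `(j, y) ↦ (j + n, y)` — a GRAPH ISOMORPHISM of the admissible bonds (2.46), so the distance (2.46) is preserved EXACTLY — and the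
# cube cover / placement bookkeeping `ιC`, `placed_refine_iff`

[4] = T. Bałaban, *Propagators and renormalization transformations for lattice gauge theories. II*, Commun. Math. Phys. **96** (1984) 223–250
[`Balaban1984PropagatorsII`]; [B9] = T. Bałaban, *Propagators for lattice gauge theories in a background field*, Commun. Math. Phys. **99** (1985)
389–434 [`Balaban1985BackgroundPropagators`]; [K] = C. King, *The U(1) Higgs model. I. The continuum limit*, Commun. Math. Phys. **102** (1986) 649–677 [`King1986`].

statement-level skeleton of published theorems with citation tags; proofs where landed; nothing here is a claim about the
Yang–Mills mass gap

THE PRINTED LOCI.  [4] (2.1)–(2.4) p. 224: a member of the family is a nested sequence `Ω₁ ⊃ Ω₂ ⊃ … ⊃ Ω_k` of unions of big blocks on the torus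
`T_η`, `η = L⁻ᵏ`, with (2.2) `dist(Ω_jᶜ, Ω_{j+1}) > RM·Lʲη`; (2.45)–(2.46) p. 231: `𝔅 = ⋃_j Λ_j`, the admissible bonds and the distance `d(y, y′)`.
[B9] p. 399: the constants depend on `d, L` only — the family ranges over ALL `(torus, k, {Ω_j}, M)`.  [K] p. 664 (the convention before
Prop. 3.8): two runs at spacings `η` and `η′ = L⁻ⁿη` are compared site by site, «when x′ ∈ T_{η′}, we denote by x that point in T_η for which
x′ ∈ Bⁿ(x)».  THE REFINED MEMBER: the same physical sequence read on the `Lⁿ`-finer torus — `k + n` levels, `Ω⁺_{j+n} := Ω_j` refined,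
`Ω⁺_1 = … = Ω⁺_{n+1} = T_{η′}` (so `Λ⁺_i = ∅` for `i ≤ n`), the SAME `M_h`, `R`, torus multiplicities `P_μ` (the fine period is
`N₀(k + n) = Lⁿ·N₀(k)`, `N0_add`).  It IS a member of the printed family («as printed»: index bookkeeping, no estimate).

WHY THIS FILE (cell `pub-ymgap`, seat `pub-ymgap-node00-def-Y` gen 19 = the OWNER of the `OpsY` instance at the record; dag-n15-a g19 LOCATED-R
«is the refinement map `x ↦ x⁺` of a `MemberY` on def-Y's road?» — it is: `MemberY` is this lineage's MODULE 3 over r03's `KIdx`).  The N15 knit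
(`T4EtaRate.EtaPairing (geo9Y x) (geo9Y x⁺) …`) needs, at the TYPE level, a site embedding with `scale_ι = +n` and `dist_ι` an EQUALITY.  This module
is the torus-family layer of that construction (no V1 `Site`/`ZMod` types): MODULE B (`Node00.MemberYRefine`: `KIdx.refine`, `MemberY.refine`, `ιY`,
`dist_ιY`) reads the carrier blocks of the index bonds through `ιB` and gets `dist_ι` from `distT_refine` below.
* §1 ARITHMETIC of the refinement factor `c = Lⁿ` (`B4Thm110ZeroBox.blk_blk` consumed BY NAME): `blk_mul_add`, `N0_add`, `bigSide_add`, the coarsening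
  `coarsen n : Π[0, N₀(k+n)) → Π[0, N₀(k))` (`z ↦ z ÷ Lⁿ`, [K]'s `x′ ↦ x`) and the lifts `liftPt n x r` (`Lⁿx + r`, `0 ≤ r < Lⁿ`), and the TORUS
  DISTANCE UNDER COARSENING `circAbs_coarsen_le` ∕ `torusSupNorm_coarsen_le`: `Lⁿ·|x − x′|_{T} ≤ |z − z′|_{T⁺} + (Lⁿ − 1)` for `x = z ÷ Lⁿ`, whence
  the transport of the separation (2.2) `sep_of_coarsen` (`R·S_j < |x − x′|_T ⟹ R·S_{j+n} < |z − z′|_{T⁺}`, by integrality).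
* §2 ★ `refineT D n : TDomains d ℓ Mh (k + n) P R`, `lev⁺ z := lev (z ÷ Lⁿ) + n`; (2.1) transported by `blk_blk` ∕ `bigSide_add`, (2.2) by §1 and the
  integrality of the torus distance (`sep_of_coarsen`).
* §3 ★ THE BLOCK EMBEDDING `ιB D n : 𝔅(D) → 𝔅(D⁺)`, `(j, y) ↦ (j + n, y)` (`scale_ιB`: level `+ n`; SAME label — the same physical block one chart
  deeper): `blkOf_refine` (`blkOf⁺ z = ιB (blkOf (z ÷ Lⁿ))`), `blkOf_liftPt`, a BIJECTION (`ιB_injective`, `ιB_surjective`, `ιBEquiv`), and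
  ★ `touchT_refine_iff`: two blocks touch across the coarse torus iff their images touch across the fine one (coarse → fine: lift the two witnesses
  to `Lⁿx + r`, `Lⁿx′ + r′` with `r_μ, r′_μ ∈ {0, Lⁿ − 1}` chosen by the sign of the centred difference; fine → coarse: §1) — so `ιB` is a graph
  ISOMORPHISM of the bond graphs (`ιBHom`, `ιBInvHom`) and ★★ `distT_refine`: `d_{T⁺}(ιB s, ιB t) = d_T(s, t)` ON THE NOSE (`geomT_refine_dist` in
  the `B6.Geometry` currency).  This is the `dist_ι` field of the η-pairing, as an equality — no inequality, no `d + 1` slack.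
* §4 THE CUBE COVER: `cubeLbl_refine`, ★ `ιC D n : cubes(D) ≃ cubes(D⁺)`, `(j, q) ↦ (j + n, q)` (`bigSide_add`), `rj_add` ∕ `qc_add` (the chart
  numerology of `B6Eq238MultiLevelTorus` depends on `k − j` only) and ★ `placed_refine_iff` ∕ `placed_refineT`: every cube of `D⁺` is placed iff
  every cube of `D` is — the `hpl` field of r03's `KIdx` transports verbatim.

RELATION TO `B6PadLevelV1.padT` (p38): `padT` pads ONE EMPTY TOP level on the SAME torus (same sites, same `lev`, `P′ = L·P″`); `refineT` passes to the
`Lⁿ`-FINER torus (new sites, `lev⁺ z = lev(z ÷ Lⁿ) + n`, same `P`) — the two commute and are independent; both keep `𝔅`, the bonds (2.46) and `d(y, y′)`.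

HONEST SCOPE.  Finite combinatorics of [4]'s index sets under `η ↦ L⁻ⁿη`; every statement is an identity or a biconditional, kernel-checked; nothing
of [4]'s or [B9]'s analysis is asserted; the η-pairing's ESTIMATE (NE2⁺ for Bałaban's `G′(U)`) is NOT PRINTED and not touched; N15 ∕ N06 NOT
discharged; COUNT-NEUTRAL (definition lane).  One finite 𝕋⁴ programme at fixed ε — nothing continuum, nothing about the mass gap.  Cell `pub-ymgap`
(HUMAN RULING D-0062), Track A node N15∕N06, seat `pub-ymgap-node00-def-Y` (g19), 2026-08-28.

REVISION v1.0.1 (doc-only, zero decl change): header prose `[K]` = King I (CMP **102**, 649–677 — where p. 664 is), per ref-E READ-17 (the cite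
keys were right; the prose was the slip).
-/

namespace Literature.MathematicalPhysics.QuantumFieldTheory.Balaban1983to89.Node00.MemberYRefineDomains

open Literature.MathematicalPhysics.QuantumFieldTheory.Balaban1983to89.B4Reflection242 (boxDom mem_boxDom blk blk_mem_boxDom)
open Literature.MathematicalPhysics.QuantumFieldTheory.Balaban1983to89.B4Thm110ZeroBox (blk_blk)
open Literature.MathematicalPhysics.QuantumFieldTheory.Balaban1983to89.B4TorusKernel.MultiPeriod (circAbs circAbs_nonneg circAbs_le_abs
  circAbs_add_mul abs_add_mul_centre centre torusSupNorm torusSupNorm_nonneg)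
open Literature.MathematicalPhysics.QuantumFieldTheory.Balaban1983to89.B6MultiLevelBoxOperator (N0 bigSide Domains one_le_bigSide)
open Literature.MathematicalPhysics.QuantumFieldTheory.Balaban1983to89.B6MultiLevelTorusOperator (TDomains one_le_of_mem)
open Literature.MathematicalPhysics.QuantumFieldTheory.Balaban1983to89.B6Geom246MultiLevelBox (bset blkOf blkOf_val exists_blkOf_eq)
open Literature.MathematicalPhysics.QuantumFieldTheory.Balaban1983to89.B6Geom246MultiLevelTorus (TouchT bondT bondT_adj geomT touchT_symm)
open Literature.MathematicalPhysics.QuantumFieldTheory.Balaban1983to89.B6Cover236MultiLevelBlocks (cubes)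
open Literature.MathematicalPhysics.QuantumFieldTheory.Balaban1983to89.B6Eq238MultiLevelTorus (rj qc)
open Literature.MathematicalPhysics.QuantumFieldTheory.Balaban1983to89.B6CubeWindowV1 (Placed)

noncomputable section

variable {d : ℕ}

/-! ## §1  Arithmetic of the refinement factor `Lⁿ`: blocks of blocks, the fine period, coarsening and lifting, the torus distance -/

section Arith

/-- `⌊(c·x + r)/c⌋ = x` for `0 ≤ r < c`. [folklore] -/
private theorem blk_mul_add {c : ℕ} (hc : 1 ≤ c) (x r : Fin (d + 1) → ℤ) (hr : ∀ i, 0 ≤ r i ∧ r i < c) :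
    blk c (fun i => (c : ℤ) * x i + r i) = x := by
  funext i
  have hc0 : (c : ℤ) ≠ 0 := by exact_mod_cast (by omega : c ≠ 0)
  simp only [blk]
  rw [add_comm, Int.add_mul_ediv_left _ _ hc0, Int.ediv_eq_zero_of_lt (hr i).1 (hr i).2, zero_add]

/-- **THE FINE PERIOD**: `N₀(k + n) = Lⁿ·N₀(k)` (same `M_h`, same multiplicities `P_μ`). [cite: Balaban1984PropagatorsII, (2.1) p.224; King1986, p.664 (η′ = L^{−n}η), dictionary] -/
theorem N0_add (ℓ Mh k n : ℕ) (P : Fin (d + 1) → ℕ) (i : Fin (d + 1)) : N0 ℓ Mh (k + n) P i = (ℓ + 1) ^ n * N0 ℓ Mh k P i := by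
  simp only [N0, pow_add]; ring

/-- big blocks one chart deeper: `S_{j+n} = Lⁿ·S_j`. [cite: Balaban1984PropagatorsII, (2.1) p.224, bookkeeping] -/
theorem bigSide_add (ℓ Mh j n : ℕ) : bigSide ℓ Mh (j + n) = (ℓ + 1) ^ n * bigSide ℓ Mh j := by
  simp only [bigSide, pow_add, pow_succ]; ring

/-- small blocks one chart deeper: `L^{j+n} = Lⁿ·Lʲ` (the order produced by `blk_blk`). [folklore] -/
private theorem pow_add_swap (ℓ j n : ℕ) : (ℓ + 1) ^ (j + n) = (ℓ + 1) ^ n * (ℓ + 1) ^ j := by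
  rw [pow_add, mul_comm]

variable {ℓ Mh k : ℕ} {P : Fin (d + 1) → ℕ}

/-- a fine box point coarsens into the coarse box: `z ÷ Lⁿ ∈ Π[0, N₀(k))` (`B4Reflection242.blk_mem_boxDom` at `N₀(k + n) = Lⁿ·N₀(k)`). [cite: King1986, p.664 («x′ ∈ Bⁿ(x)»), dictionary] -/
theorem blk_mem_boxDom_of_mem (n : ℕ) {z : Fin (d + 1) → ℤ} (hz : z ∈ boxDom (N0 ℓ Mh (k + n) P)) :
    blk ((ℓ + 1) ^ n) z ∈ boxDom (N0 ℓ Mh k P) := by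
  refine blk_mem_boxDom (Nat.one_le_pow _ _ (Nat.succ_pos ℓ)) ?_
  have h : N0 ℓ Mh (k + n) P = fun i => (ℓ + 1) ^ n * N0 ℓ Mh k P i := funext (N0_add ℓ Mh k n P)
  rw [h] at hz
  exact hz

/-- **THE COARSENING `x′ ↦ x`** («that point in T_η for which x′ ∈ Bⁿ(x)»): `z ↦ z ÷ Lⁿ` on the fundamental boxes. [cite: King1986, p.664 (convention before Prop. 3.8)] -/
def coarsen (n : ℕ) (z : ↥(boxDom (N0 ℓ Mh (k + n) P))) : ↥(boxDom (N0 ℓ Mh k P)) :=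
  ⟨blk ((ℓ + 1) ^ n) z.1, blk_mem_boxDom_of_mem n z.2⟩

/-- the data of `coarsen`. [cite: King1986, p.664, dictionary] -/
@[simp] theorem coarsen_val (n : ℕ) (z : ↥(boxDom (N0 ℓ Mh (k + n) P))) : (coarsen n z).1 = blk ((ℓ + 1) ^ n) z.1 := rfl

/-- a lift `Lⁿ·x + r`, `0 ≤ r < Lⁿ`, of a coarse box point is a fine box point. [cite: King1986, p.664 («x′ ∈ Bⁿ(x)»), dictionary] -/
theorem lift_mem_boxDom (n : ℕ) {x : Fin (d + 1) → ℤ} (hx : x ∈ boxDom (N0 ℓ Mh k P)) (r : Fin (d + 1) → ℤ)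
    (hr : ∀ i, 0 ≤ r i ∧ r i < (((ℓ + 1) ^ n : ℕ) : ℤ)) :
    (fun i => ((((ℓ + 1) ^ n : ℕ) : ℤ)) * x i + r i) ∈ boxDom (N0 ℓ Mh (k + n) P) := by
  rw [mem_boxDom] at hx ⊢
  intro i
  obtain ⟨h0, h1⟩ := hx i
  obtain ⟨hr0, hr1⟩ := hr i
  have hc : (0 : ℤ) ≤ (((ℓ + 1) ^ n : ℕ) : ℤ) := by positivity
  refine ⟨by positivity, ?_⟩
  rw [N0_add, Nat.cast_mul]
  have h1' : x i + 1 ≤ (N0 ℓ Mh k P i : ℤ) := h1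
  have hm := mul_le_mul_of_nonneg_left h1' hc
  linarith

/-- **THE LIFTS `x ↦ Lⁿx + r`** of a coarse box point (the fine points of `Bⁿ(x)`). [cite: King1986, p.664 («x′ ∈ Bⁿ(x)»), dictionary] -/
def liftPt (n : ℕ) (x : ↥(boxDom (N0 ℓ Mh k P))) (r : Fin (d + 1) → ℤ) (hr : ∀ i, 0 ≤ r i ∧ r i < (((ℓ + 1) ^ n : ℕ) : ℤ)) :
    ↥(boxDom (N0 ℓ Mh (k + n) P)) :=
  ⟨fun i => ((((ℓ + 1) ^ n : ℕ) : ℤ)) * x.1 i + r i, lift_mem_boxDom n x.2 r hr⟩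

/-- the data of `liftPt`. [cite: King1986, p.664, dictionary] -/
@[simp] theorem liftPt_val (n : ℕ) (x : ↥(boxDom (N0 ℓ Mh k P))) (r : Fin (d + 1) → ℤ)
    (hr : ∀ i, 0 ≤ r i ∧ r i < (((ℓ + 1) ^ n : ℕ) : ℤ)) (i : Fin (d + 1)) :
    (liftPt n x r hr).1 i = ((((ℓ + 1) ^ n : ℕ) : ℤ)) * x.1 i + r i := rfl

/-- `(Lⁿx + r) ÷ Lⁿ = x`. [cite: King1986, p.664 («x′ ∈ Bⁿ(x)»), dictionary] -/
@[simp] theorem coarsen_liftPt (n : ℕ) (x : ↥(boxDom (N0 ℓ Mh k P))) (r : Fin (d + 1) → ℤ)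
    (hr : ∀ i, 0 ≤ r i ∧ r i < (((ℓ + 1) ^ n : ℕ) : ℤ)) : coarsen n (liftPt n x r hr) = x := by
  apply Subtype.ext
  simp only [coarsen_val]
  exact blk_mul_add (Nat.one_le_pow _ _ (Nat.succ_pos ℓ)) x.1 r (fun i => by exact_mod_cast hr i)

/-- the zero remainder is admissible. [folklore] -/
private theorem zero_rem (ℓ n : ℕ) : ∀ i : Fin (d + 1), 0 ≤ (0 : Fin (d + 1) → ℤ) i ∧ (0 : Fin (d + 1) → ℤ) i < (((ℓ + 1) ^ n : ℕ) : ℤ) :=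
  fun _ => ⟨le_rfl, by positivity⟩

/-- **THE TORUS DISTANCE UNDER COARSENING, ONE COORDINATE**: `c·dist_{ℤ/N}(z ÷ c, z′ ÷ c) ≤ dist_{ℤ/cN}(z, z′) + (c − 1)`.
[cite: Balaban1983RegularityDecay, p.572 (periodic conditions); King1986, p.664, dictionary] -/
theorem circAbs_coarsen_le {N c : ℕ} (hN : 1 ≤ N) (hc : 1 ≤ c) (z z' : ℤ) :
    (c : ℤ) * circAbs N (z / c - z' / c) ≤ circAbs (c * N) (z - z') + ((c : ℤ) - 1) := by
  have hcN : 1 ≤ c * N := le_trans hc (Nat.le_mul_of_pos_right c hN)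
  set m := centre (c * N) (z - z') with hm
  have key : |z - z' + ((c * N : ℕ) : ℤ) * m| = circAbs (c * N) (z - z') := abs_add_mul_centre hcN _
  have h1 : circAbs N (z / c - z' / c) ≤ |z / c - z' / c + (N : ℤ) * m| := by
    have := circAbs_le_abs hN (z / c - z' / c + (N : ℤ) * m)
    rwa [circAbs_add_mul] at this
  have hcpos : (0 : ℤ) < c := by exact_mod_cast hc
  have ez : (c : ℤ) * (z / c) = z - z % c := by linarith [Int.mul_ediv_add_emod z (c : ℤ)]
  have ez' : (c : ℤ) * (z' / c) = z' - z' % c := by linarith [Int.mul_ediv_add_emod z' (c : ℤ)]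
  have hr0 : 0 ≤ z % c := Int.emod_nonneg _ hcpos.ne'
  have hr1 : z % c < c := Int.emod_lt_of_pos _ hcpos
  have hr0' : 0 ≤ z' % c := Int.emod_nonneg _ hcpos.ne'
  have hr1' : z' % c < c := Int.emod_lt_of_pos _ hcpos
  have hrem : |z % c - z' % c| ≤ (c : ℤ) - 1 := by
    rw [abs_le]; constructor <;> omega
  calc (c : ℤ) * circAbs N (z / c - z' / c) ≤ (c : ℤ) * |z / c - z' / c + (N : ℤ) * m| :=
        mul_le_mul_of_nonneg_left h1 hcpos.le
    _ = |(c : ℤ) * (z / c - z' / c + (N : ℤ) * m)| := by rw [abs_mul, abs_of_pos hcpos]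
    _ = |(z - z' + ((c * N : ℕ) : ℤ) * m) - (z % c - z' % c)| := by
        congr 1
        rw [mul_add, mul_sub, ez, ez']
        push_cast
        ring
    _ ≤ |z - z' + ((c * N : ℕ) : ℤ) * m| + |z % c - z' % c| := abs_sub _ _
    _ ≤ circAbs (c * N) (z - z') + ((c : ℤ) - 1) := by rw [key]; linarith

/-- the torus sup-distance is attained at a coordinate, hence an INTEGER. [cite: Balaban1983RegularityDecay, p.572, bookkeeping] -/
theorem exists_torusSupNorm_eq_intCast (N : Fin (d + 1) → ℕ) (x : Fin (d + 1) → ℤ) :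
    ∃ i : Fin (d + 1), torusSupNorm N x = ((circAbs (N i) (x i) : ℤ) : ℝ) := by
  obtain ⟨i, _, hi⟩ := Finset.exists_mem_eq_sup' Finset.univ_nonempty (fun i => ((circAbs (N i) (x i) : ℤ) : ℝ))
  exact ⟨i, hi⟩

/-- a coordinate distance is at most the torus sup-distance. [cite: Balaban1983RegularityDecay, p.572, bookkeeping] -/
private theorem circAbs_le_torusSupNorm (N : Fin (d + 1) → ℕ) (x : Fin (d + 1) → ℤ) (i : Fin (d + 1)) :
    ((circAbs (N i) (x i) : ℤ) : ℝ) ≤ torusSupNorm N x :=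
  Finset.le_sup' (fun i => ((circAbs (N i) (x i) : ℤ) : ℝ)) (Finset.mem_univ i)

/-- **THE TORUS DISTANCE UNDER COARSENING**: `Lⁿ·|z ÷ Lⁿ − z′ ÷ Lⁿ|_{T(k)} ≤ |z − z′|_{T(k+n)} + (Lⁿ − 1)` (fine sites at torus distance
`≤ 1` coarsen to sites at torus distance `≤ 1`; separated coarse sets lift to separated fine sets). [cite: King1986, p.664; Balaban1984PropagatorsII, (2.2) p.224, dictionary] -/
theorem torusSupNorm_coarsen_le (hN : ∀ i, 1 ≤ N0 ℓ Mh k P i) (n : ℕ) (z z' : Fin (d + 1) → ℤ) :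
    ((((ℓ + 1) ^ n : ℕ) : ℝ)) * torusSupNorm (N0 ℓ Mh k P) (blk ((ℓ + 1) ^ n) z - blk ((ℓ + 1) ^ n) z') ≤
      torusSupNorm (N0 ℓ Mh (k + n) P) (z - z') + (((((ℓ + 1) ^ n : ℕ) : ℝ)) - 1) := by
  have hc : 1 ≤ (ℓ + 1) ^ n := Nat.one_le_pow _ _ (Nat.succ_pos ℓ)
  have hc0 : (0 : ℝ) < (((ℓ + 1) ^ n : ℕ) : ℝ) := by positivity
  rw [mul_comm, ← le_div_iff₀ hc0, torusSupNorm, Finset.sup'_le_iff]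
  intro i _
  rw [le_div_iff₀ hc0, mul_comm]
  have h := circAbs_coarsen_le (hN i) hc (z i) (z' i)
  have h2 := circAbs_le_torusSupNorm (N0 ℓ Mh (k + n) P) (z - z') i
  rw [N0_add] at h2
  have h' : ((((ℓ + 1) ^ n : ℕ) : ℤ) : ℝ) * ((circAbs (N0 ℓ Mh k P i) (z i / (((ℓ + 1) ^ n : ℕ) : ℤ) - z' i / (((ℓ + 1) ^ n : ℕ) : ℤ)) : ℤ) : ℝ)
      ≤ ((circAbs ((ℓ + 1) ^ n * N0 ℓ Mh k P i) (z i - z' i) : ℤ) : ℝ) + (((((ℓ + 1) ^ n : ℕ) : ℤ) : ℝ) - 1) := by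
    exact_mod_cast h
  simp only [Int.cast_natCast] at h'
  simp only [Pi.sub_apply, blk] at h2 ⊢
  linarith

/-- **THE SEPARATION (2.2) TRANSPORTS**: if the coarsenings of two fine sites are more than `R·S_j` apart on the coarse torus, the sites are more than
`R·S_{j+n} = Lⁿ·R·S_j` apart on the fine torus (`torusSupNorm_coarsen_le` and the INTEGRALITY of the torus distance: `m_c ≥ R·S_j + 1`,
`Lⁿ·m_c ≤ m_f + Lⁿ − 1`). [cite: Balaban1984PropagatorsII, (2.2) p.224; King1986, p.664, dictionary] -/
theorem sep_of_coarsen (hN : ∀ i, 1 ≤ N0 ℓ Mh k P i) (n R j : ℕ) (z z' : Fin (d + 1) → ℤ)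
    (h : ((R * bigSide ℓ Mh j : ℕ) : ℝ) < torusSupNorm (N0 ℓ Mh k P) (blk ((ℓ + 1) ^ n) z - blk ((ℓ + 1) ^ n) z')) :
    ((R * bigSide ℓ Mh (j + n) : ℕ) : ℝ) < torusSupNorm (N0 ℓ Mh (k + n) P) (z - z') := by
  have hco := torusSupNorm_coarsen_le hN n z z'
  obtain ⟨i, hi⟩ := exists_torusSupNorm_eq_intCast (N0 ℓ Mh k P) (blk ((ℓ + 1) ^ n) z - blk ((ℓ + 1) ^ n) z')
  obtain ⟨i', hi'⟩ := exists_torusSupNorm_eq_intCast (N0 ℓ Mh (k + n) P) (z - z')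
  rw [hi] at h hco
  rw [hi'] at hco ⊢
  have key' : ((R * bigSide ℓ Mh j : ℕ) : ℤ) + 1 ≤ circAbs (N0 ℓ Mh k P i) ((blk ((ℓ + 1) ^ n) z - blk ((ℓ + 1) ^ n) z') i) := by
    have : ((R * bigSide ℓ Mh j : ℕ) : ℤ) < circAbs (N0 ℓ Mh k P i) ((blk ((ℓ + 1) ^ n) z - blk ((ℓ + 1) ^ n) z') i) := by
      exact_mod_cast h
    omega
  have hco' : ((((ℓ + 1) ^ n : ℕ) : ℤ)) * circAbs (N0 ℓ Mh k P i) ((blk ((ℓ + 1) ^ n) z - blk ((ℓ + 1) ^ n) z') i) ≤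
      circAbs (N0 ℓ Mh (k + n) P i') ((z - z') i') + ((((ℓ + 1) ^ n : ℕ) : ℤ) - 1) := by
    exact_mod_cast hco
  have hc0 : (0 : ℤ) ≤ (((ℓ + 1) ^ n : ℕ) : ℤ) := by positivity
  have hmul := mul_le_mul_of_nonneg_left key' hc0
  have goal : ((R * bigSide ℓ Mh (j + n) : ℕ) : ℤ) < circAbs (N0 ℓ Mh (k + n) P i') ((z - z') i') := by
    rw [bigSide_add]
    push_cast at hmul hco' ⊢
    nlinarith
  exact_mod_cast goal

end Arith

/-! ## §2  The refined family `D⁺ = refineT D n` on the `Lⁿ`-finer torus -/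

section Refine

variable {ℓ Mh k R : ℕ} {P : Fin (d + 1) → ℕ}

/-- **THE n-FOLD REFINEMENT OF A NESTED TORUS FAMILY** (`η ↦ η′ = L⁻ⁿη`): `k + n` levels on the torus of fine period `N₀(k + n) = Lⁿ·N₀(k)`, the level of
a fine site `z` being `lev(z ÷ Lⁿ) + n` — `Ω⁺_{j+n} = Ω_j` refined, `Ω⁺_1 = … = Ω⁺_{n+1} = T_{η′}`, `Λ⁺_i = ∅` (`i ≤ n`); (2.1) and (2.2) with the SAME
`M_h`, `R`. [cite: Balaban1984PropagatorsII, (2.1)–(2.4) p.224; King1986, p.664 (η′ = L^{−n}η, x′ ∈ Bⁿ(x))] -/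
def refineT (D : TDomains d ℓ Mh k P R) (n : ℕ) : TDomains d ℓ Mh (k + n) P R where
  lev z := D.lev (blk ((ℓ + 1) ^ n) z) + n
  one_le_lev z := le_add_right (D.one_le_lev _)
  lev_le z := Nat.add_le_add_right (D.lev_le _) n
  bigBlocks j hj z hz z' hz' hblk := by
    by_cases hjn : j ≤ n + 1
    · have h1 := D.one_le_lev (blk ((ℓ + 1) ^ n) z)
      have h2 := D.one_le_lev (blk ((ℓ + 1) ^ n) z')
      constructor <;> intro <;> omega
    · obtain ⟨j₀, rfl⟩ : ∃ j₀, j = j₀ + n := ⟨j - n, by omega⟩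
      have hj₀ : 2 ≤ j₀ := by omega
      have hblk' : blk (bigSide ℓ Mh j₀) (blk ((ℓ + 1) ^ n) z') = blk (bigSide ℓ Mh j₀) (blk ((ℓ + 1) ^ n) z) := by
        rw [blk_blk, blk_blk, ← bigSide_add]
        exact hblk
      have key := D.bigBlocks j₀ hj₀ _ (blk_mem_boxDom_of_mem n hz) _ (blk_mem_boxDom_of_mem n hz') hblk'
      omega
  sepT j z hz z' hz' h1 h2 := by
    have hl := D.one_le_lev (blk ((ℓ + 1) ^ n) z)
    obtain ⟨j₀, rfl⟩ : ∃ j₀, j = j₀ + n := ⟨j - n, by omega⟩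
    have hN : ∀ i, 1 ≤ N0 ℓ Mh k P i := fun i => one_le_of_mem (blk_mem_boxDom_of_mem n hz) i
    exact sep_of_coarsen hN n R j₀ z z'
      (D.sepT j₀ _ (blk_mem_boxDom_of_mem n hz) _ (blk_mem_boxDom_of_mem n hz') (by omega) (by omega))

/-- the level function of the refined family. [cite: Balaban1984PropagatorsII, (2.3)–(2.4) p.224; King1986, p.664] -/
@[simp] theorem refineT_lev (D : TDomains d ℓ Mh k P R) (n : ℕ) (z : Fin (d + 1) → ℤ) :
    (refineT D n).lev z = D.lev (blk ((ℓ + 1) ^ n) z) + n := rfl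

/-- the box family of the refined family has the same level function. [cite: Balaban1984PropagatorsII, (2.3)–(2.4) p.224, bookkeeping] -/
@[simp] theorem refineT_toDomains_lev (D : TDomains d ℓ Mh k P R) (n : ℕ) (z : Fin (d + 1) → ℤ) :
    (refineT D n).toDomains.lev z = D.lev (blk ((ℓ + 1) ^ n) z) + n := rfl

/-- refining by `0` steps keeps the levels. [cite: Balaban1984PropagatorsII, (2.3)–(2.4) p.224, bookkeeping] -/
theorem refineT_zero_lev (D : TDomains d ℓ Mh k P R) (z : Fin (d + 1) → ℤ) : (refineT D 0).lev z = D.lev z := by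
  simp only [refineT_lev, pow_zero, add_zero]
  congr 1
  funext i
  simp [blk]

end Refine

/-! ## §3  The block embedding `ιB : 𝔅 → 𝔅⁺` — a graph isomorphism of the admissible bonds; the distance (2.46) is preserved exactly -/

section Blocks

variable {ℓ Mh k R : ℕ} {P : Fin (d + 1) → ℕ} (D : TDomains d ℓ Mh k P R) (n : ℕ)

/-- **THE BLOCK OF A FINE SITE IS THE REFINED BLOCK OF ITS COARSENING**: `blkOf⁺ z = (j + n, y)` where `(j, y) = blkOf (z ÷ Lⁿ)` (same label:
`⌊z/L^{j+n}⌋ = ⌊(z ÷ Lⁿ)/Lʲ⌋`). [cite: Balaban1984PropagatorsII, (2.45) p.231; King1986, p.664, dictionary] -/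
theorem blkOf_refine_val (z : ↥(boxDom (N0 ℓ Mh (k + n) P))) :
    (blkOf (refineT D n).toDomains z).1 = ((blkOf D.toDomains (coarsen n z)).1.1 + n, (blkOf D.toDomains (coarsen n z)).1.2) := by
  simp only [blkOf_val, refineT_toDomains_lev, TDomains.toDomains_lev, coarsen_val, Prod.mk.injEq, true_and]
  rw [pow_add_swap, ← blk_blk]

/-- the pair `(j + n, y)` of a coarse block `(j, y)` is a block of the refined family. [cite: Balaban1984PropagatorsII, (2.45) p.231; King1986, p.664] -/
theorem shift_mem_bset (s : ↥(bset D.toDomains)) : (s.1.1 + n, s.1.2) ∈ bset (refineT D n).toDomains := by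
  obtain ⟨x, hx⟩ := exists_blkOf_eq D.toDomains s
  have hz := (blkOf (refineT D n).toDomains (liftPt n x 0 (zero_rem ℓ n))).2
  rw [blkOf_refine_val, coarsen_liftPt, hx] at hz
  exact hz

/-- **THE BLOCK EMBEDDING `ιB : 𝔅 → 𝔅⁺`**, `(j, y) ↦ (j + n, y)`: a block of the coarse run IS a block of the fine run, one chart deeper, same label
(«a site of Λ_j in run A ↦ the site of scale index j + n and the same physical size in run B»). [cite: King1986, p.664 (convention before Prop. 3.8); Balaban1984PropagatorsII, (2.45) p.231] -/
def ιB (s : ↥(bset D.toDomains)) : ↥(bset (refineT D n).toDomains) := ⟨(s.1.1 + n, s.1.2), shift_mem_bset D n s⟩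

/-- the data of `ιB`. [cite: King1986, p.664, dictionary] -/
@[simp] theorem ιB_val (s : ↥(bset D.toDomains)) : (ιB D n s).1 = (s.1.1 + n, s.1.2) := rfl

/-- **`scale_ι`**: the level shifts by `n`. [cite: King1986, p.664 («scale index j + n»)] -/
theorem scale_ιB (s : ↥(bset D.toDomains)) : (ιB D n s).1.1 = s.1.1 + n := rfl

/-- the label is kept. [cite: King1986, p.664, dictionary] -/
theorem label_ιB (s : ↥(bset D.toDomains)) : (ιB D n s).1.2 = s.1.2 := rfl

/-- `blkOf⁺ z = ιB (blkOf (z ÷ Lⁿ))`. [cite: Balaban1984PropagatorsII, (2.45) p.231; King1986, p.664] -/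
theorem blkOf_refine (z : ↥(boxDom (N0 ℓ Mh (k + n) P))) :
    blkOf (refineT D n).toDomains z = ιB D n (blkOf D.toDomains (coarsen n z)) :=
  Subtype.ext (blkOf_refine_val D n z)

/-- `blkOf⁺ (Lⁿx + r) = ιB (blkOf x)`. [cite: Balaban1984PropagatorsII, (2.45) p.231; King1986, p.664] -/
theorem blkOf_liftPt (x : ↥(boxDom (N0 ℓ Mh k P))) (r : Fin (d + 1) → ℤ) (hr : ∀ i, 0 ≤ r i ∧ r i < (((ℓ + 1) ^ n : ℕ) : ℤ)) :
    blkOf (refineT D n).toDomains (liftPt n x r hr) = ιB D n (blkOf D.toDomains x) := by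
  rw [blkOf_refine, coarsen_liftPt]

/-- `ιB` is injective. [cite: King1986, p.664, bookkeeping] -/
theorem ιB_injective : Function.Injective (ιB D n) := by
  intro s t h
  have h' := congrArg Subtype.val h
  simp only [ιB_val, Prod.mk.injEq, Nat.add_right_cancel_iff] at h'
  exact Subtype.ext (Prod.ext h'.1 h'.2)

/-- `ιB` is surjective: every block of the refined family has level `> n` and is the image of a coarse block. [cite: King1986, p.664, bookkeeping] -/
theorem ιB_surjective : Function.Surjective (ιB D n) := by
  intro t
  obtain ⟨z, rfl⟩ := exists_blkOf_eq (refineT D n).toDomains t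
  exact ⟨blkOf D.toDomains (coarsen n z), (blkOf_refine D n z).symm⟩

/-- **`𝔅 ≃ 𝔅⁺`**. [cite: King1986, p.664; Balaban1984PropagatorsII, (2.45) p.231] -/
def ιBEquiv : ↥(bset D.toDomains) ≃ ↥(bset (refineT D n).toDomains) :=
  Equiv.ofBijective (ιB D n) ⟨ιB_injective D n, ιB_surjective D n⟩

/-- the bijection is `ιB`. [cite: King1986, p.664, dictionary] -/
@[simp] theorem ιBEquiv_apply (s : ↥(bset D.toDomains)) : ιBEquiv D n s = ιB D n s := rfl

/-- `ιB (ιBEquiv⁻¹ t) = t`. [cite: King1986, p.664, dictionary] -/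
@[simp] theorem ιB_symm_apply (t : ↥(bset (refineT D n).toDomains)) : ιB D n ((ιBEquiv D n).symm t) = t :=
  (ιBEquiv D n).apply_symm_apply t

/-- `ιBEquiv⁻¹ (ιB s) = s`. [cite: King1986, p.664, dictionary] -/
@[simp] theorem symm_apply_ιB (s : ↥(bset D.toDomains)) : (ιBEquiv D n).symm (ιB D n s) = s :=
  (ιBEquiv D n).symm_apply_apply s

variable {D n}

/-- **TOUCHING IS PRESERVED BOTH WAYS**: two coarse blocks contain sites at torus distance `≤ 1` iff their refined images do (⇒: lift the witnesses to
`Lⁿx + r`, `Lⁿx′ + r′` with `r, r′ ∈ {0, Lⁿ − 1}` coordinatewise according to the sign of the centred difference; ⇐: coarsen the witnesses,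
`torusSupNorm_coarsen_le`). [cite: Balaban1984PropagatorsII, (2.46) p.231 («admissible bonds»); King1986, p.664] -/
theorem touchT_refine_iff (s t : ↥(bset D.toDomains)) : TouchT (refineT D n) (ιB D n s) (ιB D n t) ↔ TouchT D s t := by
  constructor
  · rintro ⟨z, z', hz, hz', hd⟩
    have hN : ∀ i, 1 ≤ N0 ℓ Mh k P i := fun i => one_le_of_mem (coarsen n z).2 i
    refine ⟨coarsen n z, coarsen n z', ?_, ?_, ?_⟩
    · rw [blkOf_refine] at hz; exact ιB_injective D n hz
    · rw [blkOf_refine] at hz'; exact ιB_injective D n hz'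
    · have hco := torusSupNorm_coarsen_le hN n z.1 z'.1
      have hc1 : (1 : ℝ) ≤ (((ℓ + 1) ^ n : ℕ) : ℝ) := by exact_mod_cast Nat.one_le_pow _ _ (Nat.succ_pos ℓ)
      have h0 := torusSupNorm_nonneg (fun i => one_le_of_mem (coarsen n z).2 i) ((coarsen n z).1 - (coarsen n z').1)
      simp only [coarsen_val] at h0 ⊢
      nlinarith
  · rintro ⟨x, x', hx, hx', hd⟩
    -- the centred difference `e`, `|e_i| ≤ 1`
    obtain ⟨e, he⟩ : ∃ e : Fin (d + 1) → ℤ,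
        ∀ i, e i = (x.1 - x'.1) i + (N0 ℓ Mh k P i : ℤ) * centre (N0 ℓ Mh k P i) ((x.1 - x'.1) i) := ⟨_, fun i => rfl⟩
    have hN : ∀ i, 1 ≤ N0 ℓ Mh k P i := fun i => one_le_of_mem x.2 i
    have he1 : ∀ i, |e i| ≤ 1 := by
      intro i
      have h1 := circAbs_le_torusSupNorm (N0 ℓ Mh k P) (x.1 - x'.1) i
      have h2 : ((circAbs (N0 ℓ Mh k P i) ((x.1 - x'.1) i) : ℤ) : ℝ) ≤ 1 := h1.trans hd
      have h3 : circAbs (N0 ℓ Mh k P i) ((x.1 - x'.1) i) ≤ 1 := by exact_mod_cast h2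
      rw [he i, abs_add_mul_centre (hN i)]
      exact h3
    have hc : (1 : ℤ) ≤ (((ℓ + 1) ^ n : ℕ) : ℤ) := by exact_mod_cast Nat.one_le_pow _ _ (Nat.succ_pos ℓ)
    -- the remainders `r = (Lⁿ − 1)·(−e)₊`, `r′ = (Lⁿ − 1)·e₊`
    have hr : ∀ i, 0 ≤ (fun i => ((((ℓ + 1) ^ n : ℕ) : ℤ) - 1) * max (-(e i)) 0) i ∧
        (fun i => ((((ℓ + 1) ^ n : ℕ) : ℤ) - 1) * max (-(e i)) 0) i < (((ℓ + 1) ^ n : ℕ) : ℤ) := by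
      intro i
      dsimp only
      have h1 := he1 i
      rw [abs_le] at h1
      have hm0 : 0 ≤ max (-(e i)) 0 := le_max_right _ _
      have hm1 : max (-(e i)) 0 ≤ 1 := max_le (by linarith) (by norm_num)
      constructor
      · exact mul_nonneg (by linarith) hm0
      · nlinarith
    have hr' : ∀ i, 0 ≤ (fun i => ((((ℓ + 1) ^ n : ℕ) : ℤ) - 1) * max (e i) 0) i ∧
        (fun i => ((((ℓ + 1) ^ n : ℕ) : ℤ) - 1) * max (e i) 0) i < (((ℓ + 1) ^ n : ℕ) : ℤ) := by
      intro i
      dsimp only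
      have h1 := he1 i
      rw [abs_le] at h1
      have hm0 : 0 ≤ max (e i) 0 := le_max_right _ _
      have hm1 : max (e i) 0 ≤ 1 := max_le (by linarith) (by norm_num)
      constructor
      · exact mul_nonneg (by linarith) hm0
      · nlinarith
    refine ⟨liftPt n x _ hr, liftPt n x' _ hr', ?_, ?_, ?_⟩
    · rw [blkOf_liftPt, hx]
    · rw [blkOf_liftPt, hx']
    · rw [torusSupNorm]
      refine Finset.sup'_le _ _ fun i _ => ?_
      have hcN : circAbs (N0 ℓ Mh (k + n) P i) (((liftPt n x _ hr).1 - (liftPt n x' _ hr').1) i) ≤ 1 := by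
        have hb := circAbs_le_abs (one_le_of_mem (liftPt n x _ hr).2 i)
          ((((liftPt n x _ hr).1 - (liftPt n x' _ hr').1) i) +
            (N0 ℓ Mh (k + n) P i : ℤ) * centre (N0 ℓ Mh k P i) ((x.1 - x'.1) i))
        rw [circAbs_add_mul] at hb
        refine hb.trans ?_
        have hm := max_zero_sub_max_neg_zero_eq_self (e i)
        have hei := he i
        simp only [Pi.sub_apply] at hei
        have hval : (((liftPt n x _ hr).1 - (liftPt n x' _ hr').1) i) +
            (N0 ℓ Mh (k + n) P i : ℤ) * centre (N0 ℓ Mh k P i) ((x.1 - x'.1) i) = e i := by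
          simp only [Pi.sub_apply, liftPt_val]
          rw [N0_add, Nat.cast_mul]
          linear_combination (-((((ℓ + 1) ^ n : ℕ) : ℤ))) * hei - (((((ℓ + 1) ^ n : ℕ) : ℤ)) - 1) * hm
        rw [hval]
        exact he1 i
      exact_mod_cast hcN

variable (D n)

/-- **`ιB` IS A HOMOMORPHISM OF THE BOND GRAPHS** `bondT D →g bondT D⁺`. [cite: Balaban1984PropagatorsII, (2.46) p.231; King1986, p.664] -/
def ιBHom : bondT D →g bondT (refineT D n) where
  toFun := ιB D n
  map_rel' := by
    intro s t h
    obtain ⟨hne, ht⟩ := bondT_adj.1 h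
    exact bondT_adj.2 ⟨fun he => hne (ιB_injective D n he), (touchT_refine_iff s t).2 ht⟩

/-- **… AND SO IS ITS INVERSE** `bondT D⁺ →g bondT D`: `ιB` is a graph isomorphism. [cite: Balaban1984PropagatorsII, (2.46) p.231; King1986, p.664] -/
def ιBInvHom : bondT (refineT D n) →g bondT D where
  toFun := (ιBEquiv D n).symm
  map_rel' := by
    intro u v h
    obtain ⟨s, rfl⟩ := ιB_surjective D n u
    obtain ⟨t, rfl⟩ := ιB_surjective D n v
    obtain ⟨hne, ht⟩ := bondT_adj.1 h
    rw [symm_apply_ιB, symm_apply_ιB]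
    exact bondT_adj.2 ⟨fun he => hne (congrArg _ he), (touchT_refine_iff s t).1 ht⟩

/-- the isomorphism as a Mathlib graph isomorphism. [cite: Balaban1984PropagatorsII, (2.46) p.231; King1986, p.664] -/
def ιBIso : bondT D ≃g bondT (refineT D n) where
  toEquiv := ιBEquiv D n
  map_rel_iff' := by
    intro s t
    change (bondT (refineT D n)).Adj (ιB D n s) (ιB D n t) ↔ (bondT D).Adj s t
    rw [bondT_adj, bondT_adj, touchT_refine_iff]
    exact and_congr_left' (ιB_injective D n).ne_iff

/-- **THE DISTANCE (2.46) IS PRESERVED EXACTLY**: `d_{T⁺}(ιB s, ιB t) = d_T(s, t)` (graph distance under a graph isomorphism). [cite: Balaban1984PropagatorsII, (2.46) p.231; King1986, p.664 («preserving the scaled distance d(y, y′)»)] -/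
theorem distT_refine (s t : ↥(bset D.toDomains)) : (bondT (refineT D n)).dist (ιB D n s) (ιB D n t) = (bondT D).dist s t := by
  refine le_antisymm ?_ ?_
  · by_cases hr : (bondT D).Reachable s t
    · obtain ⟨p, hp⟩ := hr.exists_walk_length_eq_dist
      rw [← hp]
      calc (bondT (refineT D n)).dist (ιB D n s) (ιB D n t) ≤ (p.map (ιBHom D n)).length := SimpleGraph.dist_le _
        _ = p.length := SimpleGraph.Walk.length_map _ _
    · have hr' : ¬ (bondT (refineT D n)).Reachable (ιB D n s) (ιB D n t) := by
        intro h
        obtain ⟨q⟩ := h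
        have hu : (ιBInvHom D n) (ιB D n s) = s := symm_apply_ιB D n s
        have hv : (ιBInvHom D n) (ιB D n t) = t := symm_apply_ιB D n t
        exact hr ⟨(q.map (ιBInvHom D n)).copy hu hv⟩
      rw [SimpleGraph.dist_eq_zero_of_not_reachable hr, SimpleGraph.dist_eq_zero_of_not_reachable hr']
  · by_cases hr : (bondT (refineT D n)).Reachable (ιB D n s) (ιB D n t)
    · obtain ⟨q, hq⟩ := hr.exists_walk_length_eq_dist
      rw [← hq]
      have q' := q.map (ιBInvHom D n)
      calc (bondT D).dist s t = (bondT D).dist ((ιBEquiv D n).symm (ιB D n s)) ((ιBEquiv D n).symm (ιB D n t)) := by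
            rw [symm_apply_ιB, symm_apply_ιB]
        _ ≤ (q.map (ιBInvHom D n)).length := SimpleGraph.dist_le _
        _ = q.length := SimpleGraph.Walk.length_map _ _
    · have hr' : ¬ (bondT D).Reachable s t := fun h => hr (h.map (ιBHom D n))
      rw [SimpleGraph.dist_eq_zero_of_not_reachable hr, SimpleGraph.dist_eq_zero_of_not_reachable hr']

/-- **`dist_ι` IN THE `B6.Geometry` CURRENCY**: `(geomT D⁺).dist (ιB s) (ιB t) = (geomT D).dist s t`. [cite: Balaban1984PropagatorsII, (2.46) p.231; King1986, p.664] -/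
theorem geomT_refine_dist (s t : ↥(bset D.toDomains)) :
    (geomT (refineT D n)).dist (ιB D n s) (ιB D n t) = (geomT D).dist s t := by
  show (((bondT (refineT D n)).dist (ιB D n s) (ιB D n t) : ℕ) : ℝ) = (((bondT D).dist s t : ℕ) : ℝ)
  rw [distT_refine]

/-- `scale_ι` in the `B6.Geometry` currency. [cite: King1986, p.664 («scale index j + n»)] -/
theorem geomT_refine_scale (s : ↥(bset D.toDomains)) : (geomT (refineT D n)).scale (ιB D n s) = (geomT D).scale s + n := rfl

/-- the scale length at `η = 1` grows by `Lⁿ`: `(geomT D⁺).len (ιB s) = Lⁿ·(geomT D).len s` (the V1 units `η = |c_f|⁻¹`, `c_f⁺ = Lⁿc_f` restore EQUAL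
physical length — MODULE B's `len_ιY`). [cite: King1986, p.664 («the same physical size»); Balaban1984PropagatorsII, (2.1) p.224] -/
theorem geomT_refine_len (s : ↥(bset D.toDomains)) :
    (geomT (refineT D n)).len (ιB D n s) = ((ℓ : ℝ) + 1) ^ n * (geomT D).len s := by
  show ((ℓ : ℝ) + 1) ^ (s.1.1 + n) * 1 = ((ℓ : ℝ) + 1) ^ n * (((ℓ : ℝ) + 1) ^ s.1.1 * 1)
  rw [pow_add]; ring

end Blocks

/-! ## §4  The cube cover and the placement of the central cubes under refinement -/

section Cubes

variable {ℓ Mh k R : ℕ} {P : Fin (d + 1) → ℕ} (D : TDomains d ℓ Mh k P R) (n : ℕ)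

/-- the cube label of a fine site is the shifted cube label of its coarsening: `(lev⁺ z, ⌊z/S_{lev⁺ z}⌋) = (j + n, ⌊x/S_j⌋)`, `x = z ÷ Lⁿ`, `j = lev x`.
[cite: Balaban1984PropagatorsII, p.229 («cubes □ of the size 2ML^jη»); King1986, p.664] -/
theorem cubeLbl_refine (z : Fin (d + 1) → ℤ) :
    ((refineT D n).toDomains.lev z, blk (bigSide ℓ Mh ((refineT D n).toDomains.lev z)) z) =
      (D.lev (blk ((ℓ + 1) ^ n) z) + n, blk (bigSide ℓ Mh (D.lev (blk ((ℓ + 1) ^ n) z))) (blk ((ℓ + 1) ^ n) z)) := by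
  simp only [refineT_toDomains_lev, Prod.mk.injEq, true_and]
  rw [bigSide_add, ← blk_blk]

/-- the shifted label of a cube of `D` is a cube of `D⁺`. [cite: Balaban1984PropagatorsII, p.229; King1986, p.664] -/
theorem shift_mem_cubes (c : ↥(cubes D.toDomains)) : (c.1.1 + n, c.1.2) ∈ cubes (refineT D n).toDomains := by
  obtain ⟨x, hx, he⟩ := Finset.mem_image.1 c.2
  refine Finset.mem_image.2 ⟨_, (liftPt n ⟨x, hx⟩ 0 (zero_rem ℓ n)).2, ?_⟩
  rw [cubeLbl_refine]
  have hco : blk ((ℓ + 1) ^ n) (liftPt n ⟨x, hx⟩ 0 (zero_rem ℓ n)).1 = x :=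
    congrArg Subtype.val (coarsen_liftPt n ⟨x, hx⟩ 0 (zero_rem ℓ n))
  rw [hco, TDomains.toDomains_lev] at *
  rw [← he]

/-- every cube of `D⁺` is a shifted cube of `D`. [cite: Balaban1984PropagatorsII, p.229; King1986, p.664] -/
theorem exists_shift_eq_of_mem_cubes (c' : ↥(cubes (refineT D n).toDomains)) :
    ∃ c : ↥(cubes D.toDomains), (c.1.1 + n, c.1.2) = c'.1 := by
  obtain ⟨z, hz, he⟩ := Finset.mem_image.1 c'.2
  refine ⟨⟨(D.lev (blk ((ℓ + 1) ^ n) z), blk (bigSide ℓ Mh (D.lev (blk ((ℓ + 1) ^ n) z))) (blk ((ℓ + 1) ^ n) z)),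
    Finset.mem_image.2 ⟨_, blk_mem_boxDom_of_mem n hz, rfl⟩⟩, ?_⟩
  rw [← he, cubeLbl_refine]

/-- **THE CUBE COVERS CORRESPOND**: `𝒟(D) ≃ 𝒟(D⁺)`, `(j, q) ↦ (j + n, q)`. [cite: Balaban1984PropagatorsII, p.229 (the cover 𝒟); King1986, p.664] -/
def ιC : ↥(cubes D.toDomains) ≃ ↥(cubes (refineT D n).toDomains) :=
  Equiv.ofBijective (fun c => ⟨(c.1.1 + n, c.1.2), shift_mem_cubes D n c⟩) ⟨by
    intro c c' h
    have h' := congrArg Subtype.val h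
    simp only [Prod.mk.injEq, Nat.add_right_cancel_iff] at h'
    exact Subtype.ext (Prod.ext h'.1 h'.2), by
    intro c'
    obtain ⟨c, hc⟩ := exists_shift_eq_of_mem_cubes D n c'
    exact ⟨c, Subtype.ext hc⟩⟩

/-- the data of `ιC`. [cite: King1986, p.664, dictionary] -/
@[simp] theorem ιC_val (c : ↥(cubes D.toDomains)) : (ιC D n c).1 = (c.1.1 + n, c.1.2) := rfl

/-- the chart ratio depends on `k − j` only: `rj ℓ (k + n) (j + n) = rj ℓ k j`. [cite: Balaban1984PropagatorsII, p.229, dictionary (charts)] -/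
theorem rj_add (ℓ k j n : ℕ) : rj ℓ (k + n) (j + n) = rj ℓ k j := by
  unfold rj; rw [Nat.add_sub_add_right]

/-- … hence so does the central label: `qc ℓ (k + n) (j + n) q = qc ℓ k j q`. [cite: Balaban1984PropagatorsII, p.229, dictionary (charts)] -/
theorem qc_add (ℓ k j n : ℕ) (q : Fin (d + 1) → ℤ) : qc ℓ (k + n) (j + n) q = qc ℓ k j q := by
  funext μ; simp only [qc, rj_add]

/-- **PLACEMENT IS INVARIANT UNDER REFINEMENT**: the cube `(j + n, q)` is placed in the refined chart iff `(j, q)` is placed. [cite: Balaban1984PropagatorsII, p.229, p.238 (window), dictionary (charts)] -/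
theorem placed_refine_iff (c : ℕ × (Fin (d + 1) → ℤ)) : Placed ℓ (k + n) P (c.1 + n, c.2) ↔ Placed ℓ k P c := by
  simp only [Placed, qc_add, rj_add]

/-- **`hpl` TRANSPORTS**: if every cube of `D` is placed, every cube of `D⁺` is placed. [cite: Balaban1984PropagatorsII, p.229, p.238, dictionary (charts)] -/
theorem placed_refineT (hpl : ∀ c : ↥(cubes D.toDomains), Placed ℓ k P c.1) (c' : ↥(cubes (refineT D n).toDomains)) :
    Placed ℓ (k + n) P c'.1 := by
  obtain ⟨c, hc⟩ := exists_shift_eq_of_mem_cubes D n c'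
  rw [← hc, placed_refine_iff]
  exact hpl c

end Cubes

end

end Literature.MathematicalPhysics.QuantumFieldTheory.Balaban1983to89.Node00.MemberYRefineDomains
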